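import Mathlib.Data.Nat.Choose.Basic
import Mathlib.Algebra.BigOperators.Intervals
import Mathlib.Algebra.Order.BigOperators.Group.Finset
import Mathlib.Tactic
import Summits.CriticalPhenomena.PercolationContinuityZ3.Theorems.PercNearOneGluingNoHeavyLowerTailUAll
import HarnessLib

/-!
# TEST(j) for every j: the off-centre two-block inequalities of the (Ω₁) programme

Support file for the Sahi / Conjecture-P programme of route `PercNearOneGluingNoHeavy`
(`--supports stmt-CriticalPhenomena-4575`, prover prim-l12-p5 gen 28; proof notes
`prim-l12-p5/OMEGA1-g27.md` §5.1, §5.6 and `prim-l12-p5/U-PROOF-g28.md`).  No definitions, no named facts,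
no sorries.

OMEGA1-g27 §5.1 reduces CORE(t) for all `t` (hence (Ω₁) for every real `θ > 0`, §1 there) to the inequalities
TEST(j), `j ≥ 0`, for pairs of blocks `(M_b, L_b, w_b)` (`M_b` tilted coins with a symmetric unimodal weight `w_b`
on their head count, `L_b` own fair buffer coins; tree `CoreBlock` notation `F_b`, `Mo_b`), `N = n₁ + n₂`,
`n_b = M_b + L_b`, `2K + j = N`:
`TEST(j):  ∑_{k₁+k₂=K} [ M₁M₂·F₁(k₁)F₂(k₂) + (N-1+j)·Mo₁(k₁)Mo₂(k₂) ] ≥ 0`.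
TEST(0) is `CoreCov.core_abstract`, TEST(1) is `OffCentre.test_one` (gen 27, abstract blocks); for `j ≥ 2` the
abstract form fails and the binomial structure is needed.  Here TEST(j) is derived for ALL `j` from THEOREM U
(`UAll.u_all`) with `κ = M₁M₂/(N-1+j)`, which is admissible because `N(N-1) - (N-j²)(N-1+j) = j(j-1)(N+j) ≥ 0`.

* `guard_vandermonde` : merging the two own buffers, `∑_k G(L₁,k,x₁)G(L₂,K-k,x₂) = G(L₁+L₂,K,x₁+x₂)`;
* `test_j` (**TEST(j), all j**) in the convolution form above, blocks written out as `CoreBlock` sums.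
-/

namespace Summit.CriticalPhenomena.PercolationContinuityZ3.Theorems

namespace TestJ

open Finset

/-- Merging two fair buffers (Vandermonde with guards):
`∑_{k ≤ K} C(L₁,k-x₁)[x₁ ≤ k] · C(L₂,K-k-x₂)[x₂ ≤ K-k] = C(L₁+L₂, K-(x₁+x₂))[x₁+x₂ ≤ K]`. -/
theorem guard_vandermonde (L₁ L₂ K x₁ x₂ : ℕ) :
    ∑ k ∈ range (K + 1), (if x₁ ≤ k then (L₁.choose (k - x₁) : ℝ) else 0) *
        (if x₂ ≤ K - k then (L₂.choose (K - k - x₂) : ℝ) else 0) =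
      (if x₁ + x₂ ≤ K then ((L₁ + L₂).choose (K - (x₁ + x₂)) : ℝ) else 0) := by
  by_cases hK : x₁ + x₂ ≤ K
  · rw [if_pos hK, ← HypMoments.vandermonde L₁ L₂ (K - (x₁ + x₂))]
    -- reindex k = x₁ + i on the nonzero terms
    symm
    apply Finset.sum_bij_ne_zero (fun i _ _ => x₁ + i)
    · intro i hi _
      have := mem_range.mp hi
      exact mem_range.mpr (by omega)
    · intro i₁ _ _ i₂ _ _ h
      have h' : x₁ + i₁ = x₁ + i₂ := h
      omega
    · intro k hk hne
      have hkK := mem_range.mp hk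
      have h1 : x₁ ≤ k := by
        by_contra hc
        rw [if_neg hc, zero_mul] at hne
        exact hne rfl
      have h2 : x₂ ≤ K - k := by
        by_contra hc
        rw [if_neg hc, mul_zero] at hne
        exact hne rfl
      refine ⟨k - x₁, mem_range.mpr (by omega), ?_, by omega⟩
      rw [if_pos h1, if_pos h2] at hne
      have e1 : K - (x₁ + x₂) - (k - x₁) = K - k - x₂ := by omega
      rw [e1]
      exact hne
    · intro i hi _
      have := mem_range.mp hi
      have e1 : x₁ + i - x₁ = i := by omega
      have e2 : K - (x₁ + i) - x₂ = K - (x₁ + x₂) - i := by omega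
      rw [if_pos (show x₁ ≤ x₁ + i by omega), if_pos (show x₂ ≤ K - (x₁ + i) by omega), e1, e2]
  · rw [if_neg hK]
    refine sum_eq_zero fun k hk => ?_
    have hkK := mem_range.mp hk
    by_cases h1 : x₁ ≤ k
    · rw [if_pos h1, if_neg (show ¬ (x₂ ≤ K - k) by omega), mul_zero]
    · rw [if_neg h1, zero_mul]

/-- **TEST(j) for every `j ≥ 0`** (OMEGA1-g27 §5.1), from THEOREM U.  Blocks `(M_b, L_b, w_b)` with symmetric
unimodal `w_b ≥ 0`, `N = M₁+L₁+M₂+L₂`, `2K + j = N`: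
`0 ≤ ∑_{k ≤ K} [ M₁M₂·F₁(k)F₂(K-k) + (N-1+j)·Mo₁(k)Mo₂(K-k) ]`. -/
theorem test_j (M₁ L₁ M₂ L₂ K j : ℕ) (hN : 2 * K + j = M₁ + L₁ + (M₂ + L₂))
    (w₁ w₂ : ℕ → ℝ) (hw₁nn : ∀ x, 0 ≤ w₁ x)
    (hw₁sym : ∀ x, x ≤ M₁ → w₁ x = w₁ (M₁ - x)) (hw₁uni : ∀ x, 2 * x + 2 ≤ M₁ → w₁ x ≤ w₁ (x + 1))
    (hw₂nn : ∀ x, 0 ≤ w₂ x)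
    (hw₂sym : ∀ x, x ≤ M₂ → w₂ x = w₂ (M₂ - x)) (hw₂uni : ∀ x, 2 * x + 2 ≤ M₂ → w₂ x ≤ w₂ (x + 1)) :
    0 ≤ ∑ k ∈ range (K + 1),
      ((M₁ : ℝ) * M₂ *
        ((∑ x ∈ range (M₁ + 1), (M₁.choose x : ℝ) * (if x ≤ k then (L₁.choose (k - x) : ℝ) else 0) * w₁ x) *
         (∑ x ∈ range (M₂ + 1), (M₂.choose x : ℝ) *
            (if x ≤ K - k then (L₂.choose (K - k - x) : ℝ) else 0) * w₂ x)) +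
       ((((M₁ + L₁ + (M₂ + L₂) : ℕ)) : ℝ) - 1 + j) *
        ((∑ x ∈ range (M₁ + 1), (M₁.choose x : ℝ) * (if x ≤ k then (L₁.choose (k - x) : ℝ) else 0) * w₁ x *
            (2 * (x : ℝ) - M₁)) *
         (∑ x ∈ range (M₂ + 1), (M₂.choose x : ℝ) *
            (if x ≤ K - k then (L₂.choose (K - k - x) : ℝ) else 0) * w₂ x * (2 * (x : ℝ) - M₂)))) := by
  -- Step 1: expand the products and bring the sum over k inside
  have hexp : ∀ k ∈ range (K + 1),
      ((M₁ : ℝ) * M₂ *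
        ((∑ x ∈ range (M₁ + 1), (M₁.choose x : ℝ) * (if x ≤ k then (L₁.choose (k - x) : ℝ) else 0) * w₁ x) *
         (∑ x ∈ range (M₂ + 1), (M₂.choose x : ℝ) *
            (if x ≤ K - k then (L₂.choose (K - k - x) : ℝ) else 0) * w₂ x)) +
       ((((M₁ + L₁ + (M₂ + L₂) : ℕ)) : ℝ) - 1 + j) *
        ((∑ x ∈ range (M₁ + 1), (M₁.choose x : ℝ) * (if x ≤ k then (L₁.choose (k - x) : ℝ) else 0) * w₁ x *
            (2 * (x : ℝ) - M₁)) *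
         (∑ x ∈ range (M₂ + 1), (M₂.choose x : ℝ) *
            (if x ≤ K - k then (L₂.choose (K - k - x) : ℝ) else 0) * w₂ x * (2 * (x : ℝ) - M₂)))) =
      ∑ x₁ ∈ range (M₁ + 1), ∑ x₂ ∈ range (M₂ + 1),
        (M₁.choose x₁ : ℝ) * w₁ x₁ * ((M₂.choose x₂ : ℝ) * w₂ x₂) *
          ((if x₁ ≤ k then (L₁.choose (k - x₁) : ℝ) else 0) *
            (if x₂ ≤ K - k then (L₂.choose (K - k - x₂) : ℝ) else 0)) *
          ((M₁ : ℝ) * M₂ + ((((M₁ + L₁ + (M₂ + L₂) : ℕ)) : ℝ) - 1 + j) *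
            ((2 * (x₁ : ℝ) - M₁) * (2 * (x₂ : ℝ) - M₂))) := by
    intro k _
    rw [sum_mul_sum, sum_mul_sum, mul_sum, mul_sum, ← sum_add_distrib]
    refine sum_congr rfl fun x₁ _ => ?_
    rw [mul_sum, mul_sum, ← sum_add_distrib]
    refine sum_congr rfl fun x₂ _ => ?_
    ring
  rw [sum_congr rfl hexp, sum_comm]
  simp_rw [sum_comm (s := range (K + 1)) (t := range (M₂ + 1))]
  -- Step 2: the inner sum over k is the merged buffer
  have hinner : ∀ x₁ ∈ range (M₁ + 1), ∀ x₂ ∈ range (M₂ + 1),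
      ∑ k ∈ range (K + 1), (M₁.choose x₁ : ℝ) * w₁ x₁ * ((M₂.choose x₂ : ℝ) * w₂ x₂) *
          ((if x₁ ≤ k then (L₁.choose (k - x₁) : ℝ) else 0) *
            (if x₂ ≤ K - k then (L₂.choose (K - k - x₂) : ℝ) else 0)) *
          ((M₁ : ℝ) * M₂ + ((((M₁ + L₁ + (M₂ + L₂) : ℕ)) : ℝ) - 1 + j) *
            ((2 * (x₁ : ℝ) - M₁) * (2 * (x₂ : ℝ) - M₂))) =
      (M₁.choose x₁ : ℝ) * w₁ x₁ * ((M₂.choose x₂ : ℝ) * w₂ x₂) *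
          (if x₁ + x₂ ≤ K then ((L₁ + L₂).choose (K - (x₁ + x₂)) : ℝ) else 0) *
          ((M₁ : ℝ) * M₂ + ((((M₁ + L₁ + (M₂ + L₂) : ℕ)) : ℝ) - 1 + j) *
            ((2 * (x₁ : ℝ) - M₁) * (2 * (x₂ : ℝ) - M₂))) := by
    intro x₁ _ x₂ _
    rw [← guard_vandermonde L₁ L₂ K x₁ x₂, mul_sum, sum_mul]
  rw [sum_congr rfl fun x₁ hx₁ => sum_congr rfl fun x₂ hx₂ => hinner x₁ hx₁ x₂ hx₂]
  -- Step 3: degenerate blocks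
  rcases Nat.eq_zero_or_pos M₁ with hM₁ | hM₁
  · subst hM₁
    refine sum_nonneg fun x₁ hx₁ => sum_nonneg fun x₂ _ => ?_
    have hx : x₁ = 0 := by have := mem_range.mp hx₁; omega
    subst hx
    have e : ((((0 : ℕ) : ℝ)) * M₂ + ((((0 + L₁ + (M₂ + L₂) : ℕ)) : ℝ) - 1 + j) *
        ((2 * (((0 : ℕ)) : ℝ) - ((0 : ℕ) : ℝ)) * (2 * (x₂ : ℝ) - M₂))) = 0 := by simp
    rw [e, mul_zero]
  rcases Nat.eq_zero_or_pos M₂ with hM₂ | hM₂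
  · subst hM₂
    refine sum_nonneg fun x₁ _ => sum_nonneg fun x₂ hx₂ => ?_
    have hx : x₂ = 0 := by have := mem_range.mp hx₂; omega
    subst hx
    have e : ((M₁ : ℝ) * ((0 : ℕ) : ℝ) + ((((M₁ + L₁ + (0 + L₂) : ℕ)) : ℝ) - 1 + j) *
        ((2 * (x₁ : ℝ) - M₁) * (2 * (((0 : ℕ)) : ℝ) - ((0 : ℕ) : ℝ)))) = 0 := by simp
    rw [e, mul_zero]
  -- Step 4: factor out N-1+j > 0 and apply THEOREM U with κ = M₁M₂/(N-1+j), L = L₁ + L₂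
  set Nr : ℝ := (((M₁ + L₁ + (M₂ + L₂) : ℕ)) : ℝ) with hNr
  have hjN : Nr - 2 * K = (j : ℝ) := by
    have : ((2 * K + j : ℕ) : ℝ) = (((M₁ + L₁ + (M₂ + L₂) : ℕ)) : ℝ) := by rw [hN]
    push_cast at this
    rw [hNr]
    push_cast
    linarith
  have hN2 : (2 : ℝ) ≤ Nr := by
    rw [hNr]
    have : ((2 : ℕ) : ℝ) ≤ (((M₁ + L₁ + (M₂ + L₂) : ℕ)) : ℝ) := by exact_mod_cast (by omega)
    exact_mod_cast this
  have hj0 : (0 : ℝ) ≤ j := by positivity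
  have hc : 0 < Nr - 1 + j := by linarith
  set κ : ℝ := (M₁ : ℝ) * M₂ / (Nr - 1 + j) with hκdef
  have hκ : 0 ≤ κ := by rw [hκdef]; positivity
  have hκ₀ : (M₁ : ℝ) * M₂ * (((M₁ + M₂ + (L₁ + L₂) : ℕ) : ℝ) - (((M₁ + M₂ + (L₁ + L₂) : ℕ) : ℝ) - 2 * K) ^ 2) ≤
      κ * (((M₁ + M₂ + (L₁ + L₂) : ℕ) : ℝ) * (((M₁ + M₂ + (L₁ + L₂) : ℕ) : ℝ) - 1)) := by
    have eN : (((M₁ + M₂ + (L₁ + L₂) : ℕ)) : ℝ) = Nr := by rw [hNr]; push_cast; ring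
    rw [eN, hjN, hκdef, div_mul_eq_mul_div, le_div_iff₀ hc]
    -- M₁M₂ (N - j²)(N-1+j) ≤ M₁M₂ N(N-1):  N(N-1) - (N-j²)(N-1+j) = j(j-1)(N+j) ≥ 0
    have hMM : 0 ≤ (M₁ : ℝ) * M₂ := by positivity
    have key : 0 ≤ Nr * (Nr - 1) - (Nr - (j : ℝ) ^ 2) * (Nr - 1 + j) := by
      have e : Nr * (Nr - 1) - (Nr - (j : ℝ) ^ 2) * (Nr - 1 + j) = (j : ℝ) * ((j : ℝ) - 1) * (Nr + j) := by ring
      rw [e]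
      rcases Nat.eq_zero_or_pos j with hj | hj
      · subst hj; simp
      · have hj1 : (1 : ℝ) ≤ j := by exact_mod_cast hj
        have : 0 ≤ (j : ℝ) * ((j : ℝ) - 1) := mul_nonneg hj0 (by linarith)
        exact mul_nonneg this (by linarith)
    nlinarith [mul_nonneg hMM key]
  have hU := UAll.u_all M₁ M₂ (L₁ + L₂) K j (by omega) κ hκ hκ₀ w₁ w₂ hw₁nn hw₁sym hw₁uni hw₂nn hw₂sym hw₂uni
  have e : ∑ x₁ ∈ range (M₁ + 1), ∑ x₂ ∈ range (M₂ + 1),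
        (M₁.choose x₁ : ℝ) * w₁ x₁ * ((M₂.choose x₂ : ℝ) * w₂ x₂) *
          (if x₁ + x₂ ≤ K then ((L₁ + L₂).choose (K - (x₁ + x₂)) : ℝ) else 0) *
          ((M₁ : ℝ) * M₂ + (Nr - 1 + j) * ((2 * (x₁ : ℝ) - M₁) * (2 * (x₂ : ℝ) - M₂))) =
      (Nr - 1 + j) * ∑ x₁ ∈ range (M₁ + 1), ∑ x₂ ∈ range (M₂ + 1),
        (M₁.choose x₁ : ℝ) * w₁ x₁ * ((M₂.choose x₂ : ℝ) * w₂ x₂) *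
          (if x₁ + x₂ ≤ K then ((L₁ + L₂).choose (K - (x₁ + x₂)) : ℝ) else 0) *
          (κ + (2 * (x₁ : ℝ) - M₁) * (2 * (x₂ : ℝ) - M₂)) := by
    rw [mul_sum]
    refine sum_congr rfl fun x₁ _ => ?_
    rw [mul_sum]
    refine sum_congr rfl fun x₂ _ => ?_
    have hMM : (M₁ : ℝ) * M₂ = (Nr - 1 + j) * κ := by
      rw [hκdef]
      field_simp
    rw [hMM]
    ring
  rw [e]
  exact mul_nonneg hc.le hU

end TestJ

end Summit.CriticalPhenomena.PercolationContinuityZ3.Theorems
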